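import Summits.QuantumFields.BalabanUV.Beta.GAN24.Lin4ParityCovariance
import Summits.QuantumFields.BalabanUV.Beta.GAN24.T2RecChargeStep

/-!
# `BalabanUV.Beta.GAN24.RelSourceHalf` — binder row G-an2-4 ∕ (CONV-C), W-slot EXIT (α) (the OWNER gan24-p1 g33's (α-END) INTENT 5 ∕ 6; his INTENT 6 l.50255
# «WHAT IT IS FOR (gen 34): the (C)^{ε} ⟸ (C) bridge of PART 2's `hC` — the `ε`-member's relative source is `½ • (b′_l + ε • P b′_l)` for the FULL member's
# relative source `b′_l = T̃_{l+1} − 𝒜^K_l T̃_l` once leaf-01's `sgnK_trK_lin4_unitK_coDress ∕ _KInvStep` and `lin4_add_of_bdd₄ ∕ lin4_smul` rewrite the cell …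
# that rewrite is NOT in this file»): **THAT REWRITE — THE RELATIVE SOURCE OF THE `ε`-MEMBER IS THE `ε`-HALF OF THE FULL MEMBER's RELATIVE SOURCE**, hypothesis-free
# (G-an2-4 FORMAL swarm → CRUX TEAM (2), leaf-01 lineage `b2b-balaban-gan24-formalise-leaf-01`, gen 72)

NOT IN PRINT; OUR BOOKKEEPING ([folklore] linearity + MY two parity commutations BY NAME; 0 `def`, 0 cited facts, 0 `def … : Prop`, 0 sorry).  HONEST FRAMING (cell
contract, verbatim): «discharging `BetaPertH` makes Bałaban's UV stability UNCONDITIONAL — a real constructive-QFT result; it is NOT the continuum limit and NOT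
the Clay problem.»  HONEST DEPENDENCY (verbatim): «continuum YM on T⁴ ⇐ BetaPertH ∧ nine spine estimates (0/9 proved); BetaPertH ⇐ (D1) ∧ (D4) ∧ CAP+tail;
G-an2-4 gates asym, D1 and NE2/3/4.»

WHAT (objects as in the (α-END) files: `T♮̃_l := unitS₂_l (T2RecAt d Lc (toSite r) … l)`, the dressed step `𝒜^Ĝ_l := lin4 c₄ (unitK_l Ĝ_l) Lc`, road W3's undressed
step `𝒜^K_l := lin4 c₄ (unitK_l K_l) Lc`, the dressed source `b̃_l`, `P := sgnK ∘ trK` slotwise, `y_l := ½ • (T♮̃_l + ε • P T♮̃_l)`, the FULL member's source RELATIVE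
to the undressed step `b′_l := T♮̃_{l+1} − 𝒜^K_l T♮̃_l` (R-HYB′ currency, where row (C) of record reads `ZfreeSym (b′_l)`); in-block root, `1 ≤ Lc`, border data
`hBff hBmm hB`; generic `d`, every `ε l`):
* §0 `parity_sub` (the slotwise parity image is subtractive — twin of MY `AffineUnrollProjected.parity_add`).
* §1 **`relSource_half_eq`**: `½ • (b̃_l + ε • P b̃_l) + (𝒜^Ĝ_l y_l − 𝒜^K_l y_l) = ½ • (b′_l + ε • P b′_l)` — p2's (F1) step at the comb letters (`T♮̃_{l+1} = 𝒜^Ĝ_l T♮̃_l +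
  b̃_l`), `P` through BOTH one-step maps (MY `Lin4ParityCovariance.sgnK_trK_lin4_unitK_coDress ∕ _KInvStep`), `lin4` linear on bounded tables (`lin4_smul ∕
  lin4_add_of_bdd₄`), `abel`.  So the END's displayed row `hC` ((C)^{ε}: `ZfreeSym` of the `ε`-member's relative source) is `ZfreeSym` of `½ • (b′_l + ε • P b′_l)` —
  which the OWNER's `ZeroModeParity.zsym_halfTable` (INTENT 6) delivers from row (C) of record `ZfreeSym (b′_l)`; that last step is NOT here (his file).
Asserts NOTHING about Bałaban's tables; 0 estimate; discharges NOTHING of (C) ∕ `hC` ∕ `hcell` ∕ «T2Shape» ∕ «T2Drift» ∕ (hW, hWall) ∕ (Q-L); (β) of record untouched;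
NEVER «G-an2-4 closed» as (CONV-C); NOT D1, NOT `BetaPertH`, NOT continuum, NOT Clay.  2026-08-23.
-/

noncomputable section

open Finset
open scoped BigOperators
open Literature.MathematicalPhysics.QuantumFieldTheory
open Literature.MathematicalPhysics.QuantumFieldTheory.Balaban1983to89
open Literature.MathematicalPhysics.QuantumFieldTheory.Balaban1983to89.Beta
open ExpKernelCalculus (MKer Decays)
open OneStepResolventKernel (Fib)
open OneStepKernelFamily (KInvStep decays_KInvStep)
open SecondOrderResponse (W2SymOfK)
open BalabanStepJetsSucc (mmRead)
open BalabanStepW2 (K3OfK M2Of)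
open AffineAveraging (box toSite)
open BalabanCompositeJets (LocStencil₂)
open AveragingMixedJetTables (mixFFAt)
open Summit.QuantumFields.BalabanUV.Beta.TameKernelCalculus (trK trK_apply)
open Summit.QuantumFields.BalabanUV.Beta.BorderedHessian (sgnK sgnK_apply)
open Summit.QuantumFields.BalabanUV.Beta.HessKerDressedUnits (unitK unitS decays_unitK)
open Summit.QuantumFields.BalabanUV.Beta.SecondOrderUnits (unitM unitS₂ unitM₂)
open Summit.QuantumFields.BalabanUV.Beta.AxialDressingRooted (coDressKBmAt decays_coDressKBmAt_KInvStep)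
open Summit.QuantumFields.BalabanUV.Beta.SpineRooted (T2RecOf T2RecAt SpureRecAt M1At T2RecOf_comb locStencil_SpureRecAt vertexFamily_M1At)
open Summit.QuantumFields.BalabanUV.Beta.MixedJetTablesPlug (hmix_an1)
open Summit.QuantumFields.BalabanUV.Beta.GAN24.CombesThomas (sfStep smStep)
open Summit.QuantumFields.BalabanUV.Beta.GAN24.T2RecursionAffine (lin4)
open Summit.QuantumFields.BalabanUV.Beta.GAN24.BiStencilZeroMode (Tab)
open Summit.QuantumFields.BalabanUV.Beta.GAN24.Lin4ZeroMode (bdd_of_locStencil₂)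
open Summit.QuantumFields.BalabanUV.Beta.GAN24.Lin4Additive (lin4_smul)
open Summit.QuantumFields.BalabanUV.Beta.GAN24.T2UnitSplitLevels (bdd₄_add lin4_add_of_bdd₄)
open Summit.QuantumFields.BalabanUV.Beta.GAN24.T2RecOfUnitSplit (unitS₂_T2RecOf_succ_eq_lin4_add step_data_of_letters)
open Summit.QuantumFields.BalabanUV.Beta.GAN24.T2RecChargeStep (shape_member)
open Summit.QuantumFields.BalabanUV.Beta.GAN24.AffineUnrollProjected (bdd₄_parity parity_add bdd₄_smul)
open Summit.QuantumFields.BalabanUV.Beta.GAN24.Lin4ParityCovariance (sgnK_trK_lin4_unitK_coDress sgnK_trK_lin4_unitK_KInvStep)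

namespace Summit.QuantumFields.BalabanUV.Beta.GAN24.RelSourceHalf

variable {d : ℕ}

/-! ## §0 The slotwise parity image is subtractive -/

/-- [folklore] The slotwise parity image is subtractive (twin of `AffineUnrollProjected.parity_add`). -/
theorem parity_sub (X Y : Fin (d + 1) → (Fin (d + 1) → ℤ) → Fin (d + 1) → (Fin (d + 1) → ℤ) → MKer (d + 1) (Fib d)) :
    (fun κ u κ' u' => sgnK (trK ((X - Y) κ u κ' u'))) =
      (fun κ u κ' u' => sgnK (trK (X κ u κ' u'))) - fun κ u κ' u' => sgnK (trK (Y κ u κ' u')) := by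
  funext κ u κ' u' x z a b
  simp only [Pi.sub_apply, sgnK_apply, trK_apply]
  ring

/-! ## §1 The relative source of the `ε`-member -/

section Comb

variable {Lc : ℕ} [NeZero Lc] {r : Fin (d + 1) → ℕ}

/-- NOT IN PRINT; OUR BOOKKEEPING.  **THE RELATIVE SOURCE OF THE `ε`-MEMBER IS THE `ε`-HALF OF THE FULL MEMBER's RELATIVE SOURCE** (every `ε l`; in-block root,
`1 ≤ Lc`; border data `hBff hBmm hB`): with `y_l := ½ • (T♮̃_l + ε • P T♮̃_l)` and `b′_l := T♮̃_{l+1} − 𝒜^K_l T♮̃_l`,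
`½ • (b̃_l + ε • P b̃_l) + (𝒜^Ĝ_l y_l − 𝒜^K_l y_l) = ½ • (b′_l + ε • P b′_l)` — the LEFT side is the END's `b^{rel,ε}_l` verbatim (`T2ShapeEvenEnd` PART 1 ∕ 2),
the RIGHT side is the `ε`-half (table-level spelling `c • (X + ε • P X)`, `c = ½`) of the R-HYB′ relative source on which row (C) of record is stated. -/
theorem relSource_half_eq (hLc : 1 ≤ Lc) (hr : r ∈ box (d + 1) Lc) (cE cVH cΛ cE₂ cB : ℝ) (Tc : Fin 4 → Fin 4 → Fin 4 → Fin 4 → ℝ)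
    {vh₂S : Tab d} (hBff : ∀ κ u κ' u' x z (α β : Fin (d + 1)), vh₂S κ u κ' u' x z (Sum.inl α) (Sum.inl β) = 0)
    (hBmm : ∀ κ u κ' u' x z (μ ν : Fin (d + 1)), vh₂S κ u κ' u' x z (Sum.inr μ) (Sum.inr ν) = 0)
    (hB : ∃ C δ : ℝ, 0 < δ ∧ LocStencil₂ vh₂S C δ) (ε : ℝ) (l : ℕ) :
    ((1 / 2 : ℝ) • ((fun κ u κ' u' => (cE₂ * (Lc : ℝ) ^ (2 * (d + 1))) • mmRead Lc (K3OfK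
            (unitK (sfStep Lc l) (smStep d Lc l) (coDressKBmAt (toSite r) Lc (KInvStep (d := d) Lc l))) Lc
            (unitS (sfStep Lc l) (smStep d Lc l) (SpureRecAt d Lc (toSite r) cE cVH cΛ l)) (unitM (sfStep Lc l) (smStep d Lc l) (M1At d Lc (toSite r) cΛ l))
            (W2SymOfK (unitK (sfStep Lc l) (smStep d Lc l) (coDressKBmAt (toSite r) Lc (KInvStep (d := d) Lc l))) Lc
              (unitS (sfStep Lc l) (smStep d Lc l) (SpureRecAt d Lc (toSite r) cE cVH cΛ l)) (unitM (sfStep Lc l) (smStep d Lc l) (M1At d Lc (toSite r) cΛ l)) 0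
              (unitM₂ (sfStep Lc l) (smStep d Lc l) (M2Of d Lc (mixFFAt (toSite r) Lc) l))) κ u κ' u') + cB • vh₂S κ u κ' u')
          + ε • fun κ u κ' u' => sgnK (trK ((fun κ u κ' u' => (cE₂ * (Lc : ℝ) ^ (2 * (d + 1))) • mmRead Lc (K3OfK
            (unitK (sfStep Lc l) (smStep d Lc l) (coDressKBmAt (toSite r) Lc (KInvStep (d := d) Lc l))) Lc
            (unitS (sfStep Lc l) (smStep d Lc l) (SpureRecAt d Lc (toSite r) cE cVH cΛ l)) (unitM (sfStep Lc l) (smStep d Lc l) (M1At d Lc (toSite r) cΛ l))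
            (W2SymOfK (unitK (sfStep Lc l) (smStep d Lc l) (coDressKBmAt (toSite r) Lc (KInvStep (d := d) Lc l))) Lc
              (unitS (sfStep Lc l) (smStep d Lc l) (SpureRecAt d Lc (toSite r) cE cVH cΛ l)) (unitM (sfStep Lc l) (smStep d Lc l) (M1At d Lc (toSite r) cΛ l)) 0
              (unitM₂ (sfStep Lc l) (smStep d Lc l) (M2Of d Lc (mixFFAt (toSite r) Lc) l))) κ u κ' u') + cB • vh₂S κ u κ' u') κ u κ' u'))))
        + (lin4 (cE₂ * (Lc : ℝ) ^ (2 * (d + 1))) (unitK (sfStep Lc l) (smStep d Lc l) (coDressKBmAt (toSite r) Lc (KInvStep (d := d) Lc l))) Lc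
              ((1 / 2 : ℝ) • (unitS₂ (sfStep Lc l) (smStep d Lc l) (T2RecAt d Lc (toSite r) cE cVH cΛ cE₂ cB Tc vh₂S (mixFFAt (toSite r) Lc) l)
          + ε • fun κ u κ' u' => sgnK (trK (unitS₂ (sfStep Lc l) (smStep d Lc l) (T2RecAt d Lc (toSite r) cE cVH cΛ cE₂ cB Tc vh₂S (mixFFAt (toSite r) Lc) l) κ u κ' u'))))
          - lin4 (cE₂ * (Lc : ℝ) ^ (2 * (d + 1))) (unitK (sfStep Lc l) (smStep d Lc l) (KInvStep (d := d) Lc l)) Lc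
              ((1 / 2 : ℝ) • (unitS₂ (sfStep Lc l) (smStep d Lc l) (T2RecAt d Lc (toSite r) cE cVH cΛ cE₂ cB Tc vh₂S (mixFFAt (toSite r) Lc) l)
          + ε • fun κ u κ' u' => sgnK (trK (unitS₂ (sfStep Lc l) (smStep d Lc l) (T2RecAt d Lc (toSite r) cE cVH cΛ cE₂ cB Tc vh₂S (mixFFAt (toSite r) Lc) l) κ u κ' u')))))
      = ((1 / 2 : ℝ) • ((unitS₂ (sfStep Lc (l + 1)) (smStep d Lc (l + 1)) (T2RecAt d Lc (toSite r) cE cVH cΛ cE₂ cB Tc vh₂S (mixFFAt (toSite r) Lc) (l + 1))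
            - lin4 (cE₂ * (Lc : ℝ) ^ (2 * (d + 1))) (unitK (sfStep Lc l) (smStep d Lc l) (KInvStep (d := d) Lc l)) Lc
              (unitS₂ (sfStep Lc l) (smStep d Lc l) (T2RecAt d Lc (toSite r) cE cVH cΛ cE₂ cB Tc vh₂S (mixFFAt (toSite r) Lc) l)))
          + ε • fun κ u κ' u' => sgnK (trK ((unitS₂ (sfStep Lc (l + 1)) (smStep d Lc (l + 1)) (T2RecAt d Lc (toSite r) cE cVH cΛ cE₂ cB Tc vh₂S (mixFFAt (toSite r) Lc) (l + 1))
            - lin4 (cE₂ * (Lc : ℝ) ^ (2 * (d + 1))) (unitK (sfStep Lc l) (smStep d Lc l) (KInvStep (d := d) Lc l)) Lc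
              (unitS₂ (sfStep Lc l) (smStep d Lc l) (T2RecAt d Lc (toSite r) cE cVH cΛ cE₂ cB Tc vh₂S (mixFFAt (toSite r) Lc) l))) κ u κ' u')))) := by
  -- p2's (F1) step at the comb letters: `T♮̃_{l+1} = 𝒜^Ĝ_l T♮̃_l + b̃_l`
  obtain ⟨C, δ, C₀, C₁, hδ, hK, h₀, hW⟩ := step_data_of_letters (fun j => coDressKBmAt (toSite r) Lc (KInvStep (d := d) Lc j))
      (SpureRecAt d Lc (toSite r) cE cVH cΛ) (M1At d Lc (toSite r) cΛ) cE₂ cB Tc hLc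
      (fun j => decays_coDressKBmAt_KInvStep (d := d) hr j) (fun j => locStencil_SpureRecAt hLc hr cE cVH cΛ j)
      (fun j => ⟨_, 1, one_pos, vertexFamily_M1At hLc hr cΛ j zero_le_one⟩) hB (hmix_an1 hLc hr) l
  have hstep := unitS₂_T2RecOf_succ_eq_lin4_add (fun j => coDressKBmAt (toSite r) Lc (KInvStep (d := d) Lc j))
      (SpureRecAt d Lc (toSite r) cE cVH cΛ) (M1At d Lc (toSite r) cΛ) cE₂ cB Tc vh₂S (mixFFAt (toSite r) Lc) hBff hBmm l hδ hK h₀ hW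
  simp only [T2RecOf_comb] at hstep
  -- the member is bounded, and so is its parity image
  obtain ⟨CT, δT, hδT, hT⟩ := shape_member hLc hr cE cVH cΛ cE₂ cB Tc hB l
  have hbU : ∃ B : ℝ, ∀ κ u κ' u' x z a b,
      |unitS₂ (sfStep Lc l) (smStep d Lc l) (T2RecAt d Lc (toSite r) cE cVH cΛ cE₂ cB Tc vh₂S (mixFFAt (toSite r) Lc) l) κ u κ' u' x z a b| ≤ B :=
    ⟨CT, bdd_of_locStencil₂ hT hδT.le⟩
  have hbP := bdd₄_smul ε (bdd₄_parity hbU)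
  obtain ⟨δG, CG, hδG, -, hG⟩ := decays_coDressKBmAt_KInvStep (d := d) hr l
  obtain ⟨δK, CK, hδK, -, hKK⟩ := decays_KInvStep (d := d) (Lc := Lc) l
  rw [hstep, parity_sub, parity_add, sgnK_trK_lin4_unitK_coDress hr l _ _ _ _ hbU, sgnK_trK_lin4_unitK_KInvStep l _ _ _ _ hbU,
    lin4_smul, lin4_smul, lin4_add_of_bdd₄ (decays_unitK (sf := sfStep Lc l) (sm := smStep d Lc l) hG) hδG _ _ hbU hbP,
    lin4_add_of_bdd₄ (decays_unitK (sf := sfStep Lc l) (sm := smStep d Lc l) hKK) hδK _ _ hbU hbP, lin4_smul, lin4_smul]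
  simp only [smul_add, smul_sub]
  abel

end Comb

end Summit.QuantumFields.BalabanUV.Beta.GAN24.RelSourceHalf

end
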